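import Literature.Analysis.FluidPDE.LocalTypeI
import Literature.Analysis.FluidPDE.SereginSverakAxisymmetric
import HarnessLib

/-!
# Seregin 2020: axisymmetric suitable weak solutions have no Type I blow-ups

Topic `Literature/Analysis/FluidPDE`; named fact (result in print, `def … : Prop`, D-0014) requested
by the route `Summit.NavierStokesRegularity.NavierStokesRegularity.Theses.LandauTail` (cruxes
`NoAxisymLandauTail`, `EnvelopeRegularity`; work item `wi-09390`).

G. Seregin, *Local regularity of axisymmetric solutions to the Navier–Stokes equations*, Anal.
Math. Phys. 10 (2020), no. 4, Paper 46 (arXiv:2006.04140), proves: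

> **Theorem 2.1.** Assume that a pair `v` and `q` is axially symmetric suitable weak solution to
> the Navier–Stokes equations in `Q` and the origin `z = 0` is a singular point of `v`. Then it is
> a Type II blowup.

with the following terminology (§1).  `Q(z₀, R) = B(x₀, R) × ]t₀ − R², t₀[` (backward parabolic
balls); the scale-invariant energy quantities (Prop. 1.4)
`A(z₀, R) = sup_{t₀−R²<t<t₀} R⁻¹ ∫_{B(x₀,R)} |v(x, t)|² dx`, `E(z₀, R) = R⁻¹ ∫_{Q(z₀,R)} |∇v|² dz`,
`C(z₀, R) = R⁻² ∫_{Q(z₀,R)} |v|³ dz`; the index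
`g(z₀) = min{limsup_{r→0} E(z₀, r), limsup_{r→0} A(z₀, r), limsup_{r→0} C(z₀, r)}`
(Prop. 1.4 (2)); "`z₀` is a regular point of `v`, i.e., there exists `0 < r ≤ R` such that
`v ∈ L_∞(Q(z₀, r))`" (Prop. 1.4); **Def. 1.7**: "Let `z₀` be a singular point. It is a Type I
blowup if `g(z₀) < ∞`. The point `z₀` is of Type II if `g(z₀) = ∞`."; **Def. 1.3** (suitable weak
solution in `Q_* = ω × ]T₁, T₂[`): `w ∈ L_{2,∞}(Q_*)`, `∇w ∈ L₂(Q_*)`, `r ∈ L_{3/2}(Q_*)`; `w`, `r`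
satisfy the Navier–Stokes equations (`ν = 1`, no force) in the sense of distributions; for a.a.
`t` the local energy inequality
`∫_ω φ|w|²(t) + 2∫∫_{T₁<t'<t} φ|∇w|² ≤ ∫∫_{T₁<t'<t} (|w|²(∂ₜφ + Δφ) + w·∇φ(|w|² + 2r))`
for all nonnegative cut-offs `φ` vanishing near the parabolic boundary; **§2**: `Q = 𝒞 × ]−1, 0[`,
`𝒞 = {x = (x', x₃) : |x'| < 1, |x₃| < 1}` the unit cylinder, and "axially symmetric with respect
to the axis `x₃`" means `v_{ϱ,φ} = v_{φ,φ} = v_{3,φ} = q_{,φ} = 0` in cylindrical coordinates.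

* `Seregin2020.blowupIndex z₀ u G` — the index `g(z₀) ∈ [0, ∞]` over the accepted CKN scaled
  quantities `cknE`, `cknA`, `cknC` (`SuitableWeak.lean`), `G` standing for the (weak) spatial
  gradient `∇u`; `Seregin2020.IsTypeIAt`, `Seregin2020.IsTypeIIAt` — Def. 1.7 over the accepted
  backward singular points `IsBackwardSingularPoint` (`LocalTypeI.lean`).
* `Seregin2020_axisymmetricSingularPoint_typeII` — **Theorem 2.1** as a named fact: for an
  axially symmetric suitable weak solution in `Q` (in the sense of Def. 1.3) whose origin is a
  (backward) singular point, `g(0) = ∞`, i.e. ALL three scaled energies have infinite upper limit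
  (`Seregin2020.blowupIndex_eq_top_iff`); equivalently (`…typeI_regular`) finiteness of any one of
  `limsup A`, `limsup E`, `limsup C` at the origin makes the origin regular.

## Rendering

Physical space `ℝ³ = EuclideanSpace ℝ (Fin 3)`, space–time `ℝ × ℝ³` written time first, as in all
accepted suitable-weak files.  The domain `Q = 𝒞 × ]−1, 0[` is the accepted Seregin–Šverák unit
cylinder `SereginSverak2009.parCyl 0 1` / `parCylOpens 0 1` (`SereginSverakAxisymmetric.lean`),
`𝒞 = SereginSverak2009.spaceCyl 0 1`.  Def. 1.3 is rendered as: the accepted local notion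
`IsSuitableWeakSolutionOn (parCylOpens 0 1) 1 0 u p` (distributional solution, `L^∞_t L²_x`,
`∇u ∈ L²`, `p ∈ L^{3/2}` on compact subsets, space–time local energy inequality against
`C_c^∞(Q)` cut-offs; CKN 1982 / Lin 1998) **plus** Def. 1.3 (1)'s GLOBAL classes on `Q`:
`esssup_{−1<t<0} ∫_𝒞 |u(t)|² < ∞`, a weak spatial gradient `G` of `u` on `Q` with
`∫∫_Q |G|² < ∞`, and `∫∫_Q |p|^{3/2} < ∞` — exactly the pattern of the accepted Albritton–Barker
class `IsSuitableWeakSolutionInBall` (`LocalTypeI.lean`) with the parabolic ball replaced by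
Seregin's cylinder.  (Def. 1.3 (3) states the energy inequality in its a.e.-time-slice form with
cut-offs not vanishing at the top time; for a.a. `t < T₂` only the cut-off below `t` enters, and
this sliced form is derived from the accepted integrated one in the tree,
`IsSuitableWeakSolutionOn.ae_localEnergy_slice_of_forall_lt`, `SuitableWeakSliced.lean`.)
Axial symmetry is imposed pointwise on every slice `u t`, `p t`, `−1 < t < 0`, through the accepted
`IsAxisymmetric` / `IsAxisymmetricScalar` (axis `x₃ = x 2`; `AxisymmetricEuler.lean`) — stronger
than symmetry of the `L³`/`L^{3/2}` classes, hence harmless as a hypothesis.  "The origin is a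
singular point" is the accepted backward notion `IsBackwardSingularPoint u 0` (`u ∉ L^∞(Q(0, r))`
for every `r > 0`, backward parabolic balls `parabolicCylinder r 0 = ]−r², 0[ × B_r`; for `r > 1`
this follows from `r ≤ 1` by monotonicity, so it is the negation of Seregin's "regular point").
The quantities `A`, `E`, `C` are the accepted `cknA` (a genuine `sup` over `t`, as printed in
Prop. 1.4), `cknE`, `cknC` on backward parabolic balls centred at `z₀ = 0`, as in §1 (in §2 the
paper finds it "convenient to replace balls `B(x₀, r)` with cylinders `𝒞(x₀, r)`"; the two
families of quantities dominate each other up to the factor `√2` in the radius, so `g = ∞` does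
not depend on the choice); `limsup_{r→0}` is Mathlib's `Filter.limsup … (𝓝[>] 0)` in the complete
lattice `ℝ≥0∞`.  The weak gradient `G` entering `E` is universally quantified together with its
defining property; any two agree a.e. on `Q ⊇ Q(0, r)`, `r ≤ 1`, so `limsup E` does not depend on
the choice.  Viscosity `ν = 1`, no force, as printed.

Not restated: Prop. 1.4 (ε-regularity; in tree as `ckn_epsilon_regularity…`,
`CKNEpsilonRegularity.lean`), the remark after Def. 1.7 (`g < ∞ ⇒ G < ∞`, Seregin 2006), §3
(critical-space corollaries).

## Mathlib / tree search

Mathlib has no Navier–Stokes theory.  Tree: `cknA/cknE/cknC`, `IsSuitableWeakSolutionOn`,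
`HasWeakSpatialGradientOn`, `parabolicCylinder` (`SuitableWeak.lean`); `IsBackwardSingularPoint`,
`IsSuitableWeakSolutionInBall`, `cknAEss` (`LocalTypeI.lean`); `SereginSverak2009.parCyl`,
`spaceCyl`, `energyA/dissipationE/cubicC` (cylinder versions), `IsAxisymmetricLocalSolution`,
`IsRegularAtOrigin` (`SereginSverakAxisymmetric.lean`); the barrier
`Literature.Barriers.NavierStokesRegularity.AxisymmetricTypeIExclusion` (Seregin–Šverák 2009,
Thm. 3.1: the POINTWISE Type I rate `|u| ≤ C/√(−t)` excluded), which the present scaled-energy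
statement strengthens (a pointwise Type I bound on `Q` gives `A(0, r) ≤ C'`, hence `g(0) < ∞`).
No in-tree statement of Seregin 2020 (`lean search 'Seregin2020'`: docstring mentions only).

## References

* G. Seregin, *Local regularity of axisymmetric solutions to the Navier–Stokes equations*, Anal.
  Math. Phys. 10 (2020), Paper No. 46 (arXiv:2006.04140): Def. 1.3, Prop. 1.4, Def. 1.7, §2,
  Thm. 2.1. [`Seregin2020`]
* G. Seregin, V. Šverák, *On Type I singularities of the local axi-symmetric solutions of the
  Navier–Stokes equations*, Comm. PDE 34 (2009), 171–201, Lemma 3.3 (the input of the proof).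
  [`SereginSverak2009`]
* L. Caffarelli, R. Kohn, L. Nirenberg, CPAM 35 (1982), §2; F. Lin, CPAM 51 (1998), Def. 1
  (suitable weak solutions). [`CaffarelliKohnNirenberg1982`, `Lin1998`]
-/

noncomputable section

open MeasureTheory Set Function Filter Topology TopologicalSpace Metric
open scoped NNReal ENNReal

namespace Literature.Analysis.FluidPDE

/-- Local notation for physical space `ℝ³ = EuclideanSpace ℝ (Fin 3)`. -/
local notation "ℝ³" => EuclideanSpace ℝ (Fin 3)

namespace Seregin2020

section Index

variable {E : Type*} [NormedAddCommGroup E] [InnerProductSpace ℝ E] [FiniteDimensional ℝ E]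
  [MeasurableSpace E] [BorelSpace E]

/-- **Seregin's blow-up index** `g(z₀) = min{limsup_{r→0} E(z₀, r), limsup_{r→0} A(z₀, r),
limsup_{r→0} C(z₀, r)} ∈ [0, ∞]` (Seregin 2020, Prop. 1.4 (2) and Def. 1.7), over the accepted CKN
scaled quantities `cknE r z₀ G` (`G` the weak spatial gradient of `u`), `cknA r z₀ u`,
`cknC r z₀ u` on the backward parabolic balls `Q(z₀, r)`, the upper limits taken along `r → 0⁺`.
[cite: Seregin2020, Def. 1.7 and Prop. 1.4 (2)] -/
def blowupIndex (z₀ : ℝ × E) (u : ℝ → E → E) (G : ℝ → E → E →L[ℝ] E) : ℝ≥0∞ :=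
  min (limsup (fun r => cknE r z₀ G) (𝓝[>] 0))
    (min (limsup (fun r => cknA r z₀ u) (𝓝[>] 0)) (limsup (fun r => cknC r z₀ u) (𝓝[>] 0)))

/-- `g(z₀) = ∞` iff all three scaled energies have infinite upper limit at `z₀`. [folklore] -/
theorem blowupIndex_eq_top_iff {z₀ : ℝ × E} {u : ℝ → E → E} {G : ℝ → E → E →L[ℝ] E} :
    blowupIndex z₀ u G = ∞ ↔
      limsup (fun r => cknE r z₀ G) (𝓝[>] 0) = ∞ ∧ limsup (fun r => cknA r z₀ u) (𝓝[>] 0) = ∞ ∧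
        limsup (fun r => cknC r z₀ u) (𝓝[>] 0) = ∞ := by
  simp only [blowupIndex, min_eq_top]

/-- `g(z₀) < ∞` iff at least one of the three scaled energies has finite upper limit at `z₀`
(the Type I alternative of Def. 1.7). [folklore] -/
theorem blowupIndex_lt_top_iff {z₀ : ℝ × E} {u : ℝ → E → E} {G : ℝ → E → E →L[ℝ] E} :
    blowupIndex z₀ u G < ∞ ↔
      limsup (fun r => cknE r z₀ G) (𝓝[>] 0) < ∞ ∨ limsup (fun r => cknA r z₀ u) (𝓝[>] 0) < ∞ ∨
        limsup (fun r => cknC r z₀ u) (𝓝[>] 0) < ∞ := by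
  simp only [blowupIndex, min_lt_iff]

/-- The index is bounded by each of the three upper limits (here: by `limsup A`). [folklore] -/
theorem blowupIndex_le_limsup_cknA (z₀ : ℝ × E) (u : ℝ → E → E) (G : ℝ → E → E →L[ℝ] E) :
    blowupIndex z₀ u G ≤ limsup (fun r => cknA r z₀ u) (𝓝[>] 0) :=
  (min_le_right _ _).trans (min_le_left _ _)

/-- The index is bounded by `limsup E`. [folklore] -/
theorem blowupIndex_le_limsup_cknE (z₀ : ℝ × E) (u : ℝ → E → E) (G : ℝ → E → E →L[ℝ] E) :
    blowupIndex z₀ u G ≤ limsup (fun r => cknE r z₀ G) (𝓝[>] 0) :=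
  min_le_left _ _

/-- The index is bounded by `limsup C`. [folklore] -/
theorem blowupIndex_le_limsup_cknC (z₀ : ℝ × E) (u : ℝ → E → E) (G : ℝ → E → E →L[ℝ] E) :
    blowupIndex z₀ u G ≤ limsup (fun r => cknC r z₀ u) (𝓝[>] 0) :=
  (min_le_right _ _).trans (min_le_right _ _)

end Index

/-- **Type I blow-up at `z₀`** (Seregin 2020, Def. 1.7): `z₀` is a singular point of `u` — in
the backward sense of the paper, `u ∉ L^∞(Q(z₀, r))` for every `r > 0` (accepted
`IsBackwardSingularPoint`) — and `g(z₀) < ∞`. [cite: Seregin2020, Def. 1.7] -/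
def IsTypeIAt (z₀ : ℝ × ℝ³) (u : ℝ → ℝ³ → ℝ³) (G : ℝ → ℝ³ → ℝ³ →L[ℝ] ℝ³) : Prop :=
  IsBackwardSingularPoint u z₀ ∧ blowupIndex z₀ u G < ∞

/-- **Type II blow-up at `z₀`** (Seregin 2020, Def. 1.7): `z₀` is a (backward) singular point of
`u` and `g(z₀) = ∞`. [cite: Seregin2020, Def. 1.7] -/
def IsTypeIIAt (z₀ : ℝ × ℝ³) (u : ℝ → ℝ³ → ℝ³) (G : ℝ → ℝ³ → ℝ³ →L[ℝ] ℝ³) : Prop :=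
  IsBackwardSingularPoint u z₀ ∧ blowupIndex z₀ u G = ∞

/-- A singular point is of exactly one of the two types (Def. 1.7 is a dichotomy). [folklore] -/
theorem isTypeIAt_or_isTypeIIAt {z₀ : ℝ × ℝ³} {u : ℝ → ℝ³ → ℝ³} {G : ℝ → ℝ³ → ℝ³ →L[ℝ] ℝ³}
    (h : IsBackwardSingularPoint u z₀) : IsTypeIAt z₀ u G ∨ IsTypeIIAt z₀ u G := by
  rcases eq_or_ne (blowupIndex z₀ u G) ∞ with htop | htop
  · exact Or.inr ⟨h, htop⟩
  · exact Or.inl ⟨h, lt_top_iff_ne_top.mpr htop⟩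

/-- Type II blow-ups are not of Type I. [folklore] -/
theorem IsTypeIIAt.not_isTypeIAt {z₀ : ℝ × ℝ³} {u : ℝ → ℝ³ → ℝ³} {G : ℝ → ℝ³ → ℝ³ →L[ℝ] ℝ³}
    (h : IsTypeIIAt z₀ u G) : ¬ IsTypeIAt z₀ u G := fun h' =>
  (h'.2.trans_eq h.2.symm |>.ne) rfl

end Seregin2020

/-! ### Theorem 2.1 -/

/-- **Seregin 2020, Theorem 2.1 (axisymmetric suitable weak solutions have no Type I blow-ups).**
"Assume that a pair `v` and `q` is axially symmetric suitable weak solution to the Navier–Stokes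
equations in `Q` and the origin `z = 0` is a singular point of `v`. Then it is a Type II blowup",
i.e. `g(0) = min{limsup_{r→0} E(0,r), limsup_{r→0} A(0,r), limsup_{r→0} C(0,r)} = ∞` (Def. 1.7).
Hypotheses (see the module docstring for the rendering): `(u, p)` is a suitable weak solution of
Navier–Stokes (`ν = 1`, no force) in `Q = 𝒞 × ]−1, 0[` in the sense of Def. 1.3 — the accepted
local notion `IsSuitableWeakSolutionOn` on `Q` together with the global classes
`u ∈ L_{2,∞}(Q)`, `∇u = G ∈ L₂(Q)` (a weak spatial gradient on `Q`), `p ∈ L_{3/2}(Q)` —, every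
slice `u t`, `p t` (`−1 < t < 0`) is axisymmetric about the `x₃`-axis, and the origin is a
backward singular point; conclusion: `Seregin2020.blowupIndex 0 u G = ∞` over the accepted
`cknE/cknA/cknC`. [cite: Seregin2020, Thm 2.1 (with Def. 1.3, Def. 1.7)] -/
def Seregin2020_axisymmetricSingularPoint_typeII : Prop :=
  ∀ (u : ℝ → ℝ³ → ℝ³) (p : ℝ → ℝ³ → ℝ) (G : ℝ → ℝ³ → ℝ³ →L[ℝ] ℝ³),
    IsSuitableWeakSolutionOn (SereginSverak2009.parCylOpens 0 1) 1 0 u p →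
    (∃ C : ℝ≥0, ∀ᵐ t ∂(volume.restrict (Ioo (-1 : ℝ) 0)),
      ∫⁻ x in SereginSverak2009.spaceCyl 0 1, ‖u t x‖ₑ ^ 2 ≤ C) →
    HasWeakSpatialGradientOn (SereginSverak2009.parCylOpens 0 1) u G →
    (∫⁻ z in SereginSverak2009.parCyl 0 1, ENNReal.ofReal (frobeniusNormSq (G z.1 z.2)) < ∞) →
    (∫⁻ z in SereginSverak2009.parCyl 0 1, ‖p z.1 z.2‖ₑ ^ (3 / 2 : ℝ) < ∞) →
    (∀ t ∈ Ioo (-1 : ℝ) 0, IsAxisymmetric (u t)) →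
    (∀ t ∈ Ioo (-1 : ℝ) 0, IsAxisymmetricScalar (p t)) →
    IsBackwardSingularPoint u 0 →
    Seregin2020.blowupIndex 0 u G = ∞

/-! ### API -/

namespace Seregin2020_axisymmetricSingularPoint_typeII

variable {u : ℝ → ℝ³ → ℝ³} {p : ℝ → ℝ³ → ℝ} {G : ℝ → ℝ³ → ℝ³ →L[ℝ] ℝ³}

/-- Theorem 2.1 in the words of Def. 1.7: under its hypotheses the origin is a Type II blow-up.
[cite: Seregin2020, Thm 2.1] -/
theorem isTypeIIAt (h : Seregin2020_axisymmetricSingularPoint_typeII)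
    (hsw : IsSuitableWeakSolutionOn (SereginSverak2009.parCylOpens 0 1) 1 0 u p)
    (hA : ∃ C : ℝ≥0, ∀ᵐ t ∂(volume.restrict (Ioo (-1 : ℝ) 0)),
      ∫⁻ x in SereginSverak2009.spaceCyl 0 1, ‖u t x‖ₑ ^ 2 ≤ C)
    (hG : HasWeakSpatialGradientOn (SereginSverak2009.parCylOpens 0 1) u G)
    (hE : ∫⁻ z in SereginSverak2009.parCyl 0 1, ENNReal.ofReal (frobeniusNormSq (G z.1 z.2)) < ∞)
    (hp : ∫⁻ z in SereginSverak2009.parCyl 0 1, ‖p z.1 z.2‖ₑ ^ (3 / 2 : ℝ) < ∞)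
    (hu_ax : ∀ t ∈ Ioo (-1 : ℝ) 0, IsAxisymmetric (u t))
    (hp_ax : ∀ t ∈ Ioo (-1 : ℝ) 0, IsAxisymmetricScalar (p t))
    (hsing : IsBackwardSingularPoint u 0) : Seregin2020.IsTypeIIAt 0 u G :=
  ⟨hsing, h u p G hsw hA hG hE hp hu_ax hp_ax hsing⟩

/-- Theorem 2.1, unpacked: all three scaled energies diverge at an axisymmetric singular point,
`limsup E(0,r) = limsup A(0,r) = limsup C(0,r) = ∞`. [cite: Seregin2020, Thm 2.1] -/
theorem limsup_eq_top (h : Seregin2020_axisymmetricSingularPoint_typeII)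
    (hsw : IsSuitableWeakSolutionOn (SereginSverak2009.parCylOpens 0 1) 1 0 u p)
    (hA : ∃ C : ℝ≥0, ∀ᵐ t ∂(volume.restrict (Ioo (-1 : ℝ) 0)),
      ∫⁻ x in SereginSverak2009.spaceCyl 0 1, ‖u t x‖ₑ ^ 2 ≤ C)
    (hG : HasWeakSpatialGradientOn (SereginSverak2009.parCylOpens 0 1) u G)
    (hE : ∫⁻ z in SereginSverak2009.parCyl 0 1, ENNReal.ofReal (frobeniusNormSq (G z.1 z.2)) < ∞)
    (hp : ∫⁻ z in SereginSverak2009.parCyl 0 1, ‖p z.1 z.2‖ₑ ^ (3 / 2 : ℝ) < ∞)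
    (hu_ax : ∀ t ∈ Ioo (-1 : ℝ) 0, IsAxisymmetric (u t))
    (hp_ax : ∀ t ∈ Ioo (-1 : ℝ) 0, IsAxisymmetricScalar (p t))
    (hsing : IsBackwardSingularPoint u 0) :
    limsup (fun r => cknE r (0 : ℝ × ℝ³) G) (𝓝[>] 0) = ∞ ∧
      limsup (fun r => cknA r (0 : ℝ × ℝ³) u) (𝓝[>] 0) = ∞ ∧
      limsup (fun r => cknC r (0 : ℝ × ℝ³) u) (𝓝[>] 0) = ∞ :=
  Seregin2020.blowupIndex_eq_top_iff.mp (h u p G hsw hA hG hE hp hu_ax hp_ax hsing)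

/-- Theorem 2.1, contrapositive ("axially symmetric energy solutions have no Type I blowups"):
if one of `limsup E(0,r)`, `limsup A(0,r)`, `limsup C(0,r)` is finite (`g(0) < ∞`), the origin is
NOT a backward singular point, i.e. `u ∈ L^∞(Q(0, r))` for some `r > 0`.
[cite: Seregin2020, Thm 2.1 and Abstract] -/
theorem typeI_regular (h : Seregin2020_axisymmetricSingularPoint_typeII)
    (hsw : IsSuitableWeakSolutionOn (SereginSverak2009.parCylOpens 0 1) 1 0 u p)
    (hA : ∃ C : ℝ≥0, ∀ᵐ t ∂(volume.restrict (Ioo (-1 : ℝ) 0)),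
      ∫⁻ x in SereginSverak2009.spaceCyl 0 1, ‖u t x‖ₑ ^ 2 ≤ C)
    (hG : HasWeakSpatialGradientOn (SereginSverak2009.parCylOpens 0 1) u G)
    (hE : ∫⁻ z in SereginSverak2009.parCyl 0 1, ENNReal.ofReal (frobeniusNormSq (G z.1 z.2)) < ∞)
    (hp : ∫⁻ z in SereginSverak2009.parCyl 0 1, ‖p z.1 z.2‖ₑ ^ (3 / 2 : ℝ) < ∞)
    (hu_ax : ∀ t ∈ Ioo (-1 : ℝ) 0, IsAxisymmetric (u t))
    (hp_ax : ∀ t ∈ Ioo (-1 : ℝ) 0, IsAxisymmetricScalar (p t))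
    (hI : Seregin2020.blowupIndex 0 u G < ∞) :
    ∃ r > 0, eLpNorm (uncurry u) ∞ (volume.restrict (parabolicCylinder r (0 : ℝ × ℝ³))) < ∞ := by
  by_contra hreg
  push Not at hreg
  have hsing : IsBackwardSingularPoint u 0 := fun r hr =>
    top_le_iff.mp (hreg r hr)
  exact hI.ne (h u p G hsw hA hG hE hp hu_ax hp_ax hsing)

/-- No axisymmetric Type I blow-up (Def. 1.7) at the origin under the hypotheses of Theorem 2.1.
[cite: Seregin2020, Thm 2.1] -/
theorem not_isTypeIAt (h : Seregin2020_axisymmetricSingularPoint_typeII)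
    (hsw : IsSuitableWeakSolutionOn (SereginSverak2009.parCylOpens 0 1) 1 0 u p)
    (hA : ∃ C : ℝ≥0, ∀ᵐ t ∂(volume.restrict (Ioo (-1 : ℝ) 0)),
      ∫⁻ x in SereginSverak2009.spaceCyl 0 1, ‖u t x‖ₑ ^ 2 ≤ C)
    (hG : HasWeakSpatialGradientOn (SereginSverak2009.parCylOpens 0 1) u G)
    (hE : ∫⁻ z in SereginSverak2009.parCyl 0 1, ENNReal.ofReal (frobeniusNormSq (G z.1 z.2)) < ∞)
    (hp : ∫⁻ z in SereginSverak2009.parCyl 0 1, ‖p z.1 z.2‖ₑ ^ (3 / 2 : ℝ) < ∞)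
    (hu_ax : ∀ t ∈ Ioo (-1 : ℝ) 0, IsAxisymmetric (u t))
    (hp_ax : ∀ t ∈ Ioo (-1 : ℝ) 0, IsAxisymmetricScalar (p t)) :
    ¬ Seregin2020.IsTypeIAt 0 u G := fun hI =>
  (isTypeIIAt h hsw hA hG hE hp hu_ax hp_ax hI.1).not_isTypeIAt hI

end Seregin2020_axisymmetricSingularPoint_typeII

end Literature.Analysis.FluidPDE
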